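import Summits.Parity.BatemanHorn.Theses.RoughParitySectors
import Summits.Parity.BatemanHorn.Theorems.RoughParitySectorsRoughParityBalanceReduction
import Summits.Parity.BatemanHorn.Theorems.RoughParitySectorsOddSectorShareNonlinearExactness

/-!
# STRATEGY-CENSUS typed companion (crux-strategist s1, 2026-08-17) — crux `RoughParityBalance` (stmt-Parity-15627)

Companion to `Cruxes/RoughParityBalance/STRATEGY-CENSUS.md` (same seat).  Nothing here is a line or
a stub; nothing touches the lead's skeleton `Lines/birth.lean`.  Contents (all sorry-free):

* §D6 — the ROUTE-LEVEL SPLIT that is available (not filed; see the census for why): the two open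
  atoms of the registered skeleton as `Prop`s `NonlinearMemberSign`, `JointSignIndependence`, and the
  glue `RoughParityBalance_of_subs : NonlinearMemberSign → JointSignIndependence → RoughParityBalance`,
  PROVED from the landed `Birth.stub_linearMemberSign` (p149574) and a verbatim copy of the skeleton's
  kernel-checked Walsh identity / composition (`walsh_allOdd`, `roughParityBalance_of_parts`, copied
  from `Lines/birth.lean` so that this file imports only `Theorems/`).
* §D3 — the seam of the "medium/large parity-mixing" split: for `±1`-valued `a, b` on a finite set,
  `Σ a·b = Σ_{b=1} a − Σ_{b=−1} a` (`sum_mul_sign_eq_sub`) and conversely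
  `2·Σ_{b=1} a = Σ a + Σ a·b` (`two_mul_sum_filter_eq`): conditioning the medium-prime parity `a`
  on the large-cofactor parity `b` is EQUIVALENT to the product statement once `Σ a` is known to be
  small — the second piece of that split is the crux in costume.
* §T6 — the landed "two out of three" per system (`Exactness.balance_of_asymptotic_of_share`):
  `BH_f ∧ A_f ⟹ P_f`; recorded as an `example` so the census can cite it by name.
-/

namespace Summit.Parity.BatemanHorn.Cruxes.RoughParityBalance.StrategistS1

open scoped BigOperators Classical
open Filter Finset
open Literature.NumberTheory.Sieve
open Summit.Parity.BatemanHorn.Theses.RoughParitySectors (RoughParityBalance)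

set_option linter.unusedVariables false

/-! ## §D6  The two open atoms as Props (verbatim the registered stub statements) -/

/-- Atom (a): first-order Walsh coefficient of a NON-LINEAR member on the jointly rough set is `o(#R)`
(= registered `stub_nonlinearMemberSign`, verbatim). -/
def NonlinearMemberSign : Prop :=
    ∀ (k : ℕ) (f : Fin k → Polynomial ℤ), IsBatemanHornSystem f →
      ∀ i : Fin k, 2 ≤ (f i).natDegree → ∀ δ : ℝ, 0 < δ → ∃ U₀ : ℝ, ∀ U : ℝ, U₀ ≤ U →
        ∀ᶠ x : ℕ in Filter.atTop,
          |∑ n ∈ (Finset.Icc 1 x).filter (fun n : ℕ => ∀ i, 0 < (f i).eval (n : ℤ) ∧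
              ∀ p ∈ Finset.range ⌈(x : ℝ) ^ (((f i).natDegree : ℝ) / U)⌉₊,
                p.Prime → ¬ ((p : ℤ) ∣ (f i).eval (n : ℤ))),
              (-1 : ℝ) ^ ArithmeticFunction.cardFactors (((f i).eval (n : ℤ)).toNat)| ≤
            δ * ((((Finset.Icc 1 x).filter (fun n : ℕ => ∀ i, 0 < (f i).eval (n : ℤ) ∧
              ∀ p ∈ Finset.range ⌈(x : ℝ) ^ (((f i).natDegree : ℝ) / U)⌉₊,
                p.Prime → ¬ ((p : ℤ) ∣ (f i).eval (n : ℤ)))).card : ℕ) : ℝ)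

/-- Atom (b): every higher-order Walsh coefficient (`|S| ≥ 2`) on the jointly rough set is `o(#R)`
(= registered `stub_jointSignIndependence`, verbatim). -/
def JointSignIndependence : Prop :=
    ∀ (k : ℕ) (f : Fin k → Polynomial ℤ), IsBatemanHornSystem f →
      ∀ S : Finset (Fin k), 2 ≤ S.card → ∀ δ : ℝ, 0 < δ → ∃ U₀ : ℝ, ∀ U : ℝ, U₀ ≤ U →
        ∀ᶠ x : ℕ in Filter.atTop,
          |∑ n ∈ (Finset.Icc 1 x).filter (fun n : ℕ => ∀ i, 0 < (f i).eval (n : ℤ) ∧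
              ∀ p ∈ Finset.range ⌈(x : ℝ) ^ (((f i).natDegree : ℝ) / U)⌉₊,
                p.Prime → ¬ ((p : ℤ) ∣ (f i).eval (n : ℤ))),
              ∏ i ∈ S, (-1 : ℝ) ^ ArithmeticFunction.cardFactors (((f i).eval (n : ℤ)).toNat)| ≤
            δ * ((((Finset.Icc 1 x).filter (fun n : ℕ => ∀ i, 0 < (f i).eval (n : ℤ) ∧
              ∀ p ∈ Finset.range ⌈(x : ℝ) ^ (((f i).natDegree : ℝ) / U)⌉₊,
                p.Prime → ¬ ((p : ℤ) ∣ (f i).eval (n : ℤ)))).card : ℕ) : ℝ)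

/-! ## Walsh identity and composition — VERBATIM COPY of the kernel-checked text of `Lines/birth.lean`
(lines 203–352 there; authors: planner-skel-stmt-Parity-15627-0 / lead prover), so that this file depends
only on landed `Theorems/`. -/

/-- **Walsh sign-split of the all-odd cell** (exact, for every finite set `R` and every `Ω : ι → α → ℕ`):
`2^{|ι|} · #{n ∈ R : ∀ i, Ω i n odd} = Σ_{S ⊆ ι} (−1)^{|S|} Σ_{n ∈ R} ∏_{i ∈ S} (−1)^{Ω i n}`.
Proof: `∏ᵢ (1 − (−1)^{Ωᵢ(n)})` is `2^{|ι|}` if every `Ωᵢ(n)` is odd and `0` otherwise; expand the product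
(`Finset.prod_one_add`, `Finset.prod_neg`) and exchange the sums. [folklore] -/
theorem walsh_allOdd {ι α : Type*} [Fintype ι] (R : Finset α) (Ω : ι → α → ℕ)
    [DecidablePred fun n => ∀ i, Odd (Ω i n)] :
    (2 : ℝ) ^ Fintype.card ι * ((R.filter (fun n => ∀ i, Odd (Ω i n))).card : ℝ) =
      ∑ S : Finset ι, (-1 : ℝ) ^ S.card * ∑ n ∈ R, ∏ i ∈ S, (-1 : ℝ) ^ (Ω i n) := by
  -- expand the product over `univ`: `∏ᵢ (1 - aᵢ) = Σ_S (−1)^{|S|} ∏_{i∈S} aᵢ`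
  have hexp : ∀ n : α, ∏ i : ι, (1 - (-1 : ℝ) ^ (Ω i n)) =
      ∑ S : Finset ι, (-1 : ℝ) ^ S.card * ∏ i ∈ S, (-1 : ℝ) ^ (Ω i n) := by
    intro n
    have := Finset.prod_one_add (s := (Finset.univ : Finset ι)) (f := fun i => -((-1 : ℝ) ^ (Ω i n)))
    simp only [Finset.powerset_univ] at this
    simp only [sub_eq_add_neg]
    rw [this]
    refine Finset.sum_congr rfl fun S _ => ?_
    rw [Finset.prod_neg]
  -- the left side as the sum over `R` of the pointwise product (`2^{|ι|}` if all odd, else `0`)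
  have hL : (2 : ℝ) ^ Fintype.card ι * ((R.filter (fun n => ∀ i, Odd (Ω i n))).card : ℝ) =
      ∑ n ∈ R, ∏ i : ι, (1 - (-1 : ℝ) ^ (Ω i n)) := by
    rw [mul_comm, ← nsmul_eq_mul, ← Finset.sum_const, Finset.sum_filter]
    refine Finset.sum_congr rfl fun n _ => ?_
    split_ifs with h
    · rw [← Finset.card_univ, ← Finset.prod_const]
      refine Finset.prod_congr rfl fun i _ => ?_
      rw [(h i).neg_one_pow]; norm_num
    · simp only [not_forall, Nat.not_odd_iff_even] at h
      obtain ⟨i, hi⟩ := h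
      exact (Finset.prod_eq_zero (Finset.mem_univ i) (by rw [hi.neg_one_pow]; norm_num)).symm
  rw [hL, Finset.sum_congr rfl fun n _ => hexp n, Finset.sum_comm]
  exact Finset.sum_congr rfl fun S _ => (Finset.mul_sum _ _ _).symm

/-! ## Composition (REAL proof): the three stub STATEMENTS imply the crux BODY -/

/-- **Composition in hypothesis form.**  The statements of `stub_linearMemberSign`,
`stub_nonlinearMemberSign`, `stub_jointSignIndependence` imply the body of
`RoughParitySectors.RoughParityBalance`: per non-empty `S ⊆ Fin k` take the owning stub at tolerance
`δ/2^k`, `U₀ = max_S U₀(S)`, intersect the eventual sets, Walsh (`walsh_allOdd`), split off `E_∅ = #R`,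
triangle inequality over the `2^k − 1 ≤ 2^k` non-empty `S`. -/
theorem roughParityBalance_of_parts
    (h₁ : ∀ (k : ℕ) (f : Fin k → Polynomial ℤ), IsBatemanHornSystem f →
      ∀ i : Fin k, (f i).natDegree = 1 → ∀ δ : ℝ, 0 < δ → ∃ U₀ : ℝ, ∀ U : ℝ, U₀ ≤ U →
        ∀ᶠ x : ℕ in Filter.atTop,
          |∑ n ∈ (Finset.Icc 1 x).filter (fun n : ℕ => ∀ i, 0 < (f i).eval (n : ℤ) ∧
              ∀ p ∈ Finset.range ⌈(x : ℝ) ^ (((f i).natDegree : ℝ) / U)⌉₊,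
                p.Prime → ¬ ((p : ℤ) ∣ (f i).eval (n : ℤ))),
              (-1 : ℝ) ^ ArithmeticFunction.cardFactors (((f i).eval (n : ℤ)).toNat)| ≤
            δ * ((((Finset.Icc 1 x).filter (fun n : ℕ => ∀ i, 0 < (f i).eval (n : ℤ) ∧
              ∀ p ∈ Finset.range ⌈(x : ℝ) ^ (((f i).natDegree : ℝ) / U)⌉₊,
                p.Prime → ¬ ((p : ℤ) ∣ (f i).eval (n : ℤ)))).card : ℕ) : ℝ))
    (h₂ : ∀ (k : ℕ) (f : Fin k → Polynomial ℤ), IsBatemanHornSystem f →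
      ∀ i : Fin k, 2 ≤ (f i).natDegree → ∀ δ : ℝ, 0 < δ → ∃ U₀ : ℝ, ∀ U : ℝ, U₀ ≤ U →
        ∀ᶠ x : ℕ in Filter.atTop,
          |∑ n ∈ (Finset.Icc 1 x).filter (fun n : ℕ => ∀ i, 0 < (f i).eval (n : ℤ) ∧
              ∀ p ∈ Finset.range ⌈(x : ℝ) ^ (((f i).natDegree : ℝ) / U)⌉₊,
                p.Prime → ¬ ((p : ℤ) ∣ (f i).eval (n : ℤ))),
              (-1 : ℝ) ^ ArithmeticFunction.cardFactors (((f i).eval (n : ℤ)).toNat)| ≤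
            δ * ((((Finset.Icc 1 x).filter (fun n : ℕ => ∀ i, 0 < (f i).eval (n : ℤ) ∧
              ∀ p ∈ Finset.range ⌈(x : ℝ) ^ (((f i).natDegree : ℝ) / U)⌉₊,
                p.Prime → ¬ ((p : ℤ) ∣ (f i).eval (n : ℤ)))).card : ℕ) : ℝ))
    (h₃ : ∀ (k : ℕ) (f : Fin k → Polynomial ℤ), IsBatemanHornSystem f →
      ∀ S : Finset (Fin k), 2 ≤ S.card → ∀ δ : ℝ, 0 < δ → ∃ U₀ : ℝ, ∀ U : ℝ, U₀ ≤ U →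
        ∀ᶠ x : ℕ in Filter.atTop,
          |∑ n ∈ (Finset.Icc 1 x).filter (fun n : ℕ => ∀ i, 0 < (f i).eval (n : ℤ) ∧
              ∀ p ∈ Finset.range ⌈(x : ℝ) ^ (((f i).natDegree : ℝ) / U)⌉₊,
                p.Prime → ¬ ((p : ℤ) ∣ (f i).eval (n : ℤ))),
              ∏ i ∈ S, (-1 : ℝ) ^ ArithmeticFunction.cardFactors (((f i).eval (n : ℤ)).toNat)| ≤
            δ * ((((Finset.Icc 1 x).filter (fun n : ℕ => ∀ i, 0 < (f i).eval (n : ℤ) ∧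
              ∀ p ∈ Finset.range ⌈(x : ℝ) ^ (((f i).natDegree : ℝ) / U)⌉₊,
                p.Prime → ¬ ((p : ℤ) ∣ (f i).eval (n : ℤ)))).card : ℕ) : ℝ)) :
    ∀ (k : ℕ) (f : Fin k → Polynomial ℤ), Literature.NumberTheory.Sieve.IsBatemanHornSystem f →
      ∀ δ : ℝ, 0 < δ → ∃ U₀ : ℝ, ∀ U : ℝ, U₀ ≤ U → ∀ᶠ x : ℕ in Filter.atTop,
        |(2 : ℝ) ^ k * (((((Finset.Icc 1 x).filter (fun n : ℕ => ∀ i, 0 < (f i).eval (n : ℤ) ∧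
            ∀ p ∈ Finset.range ⌈(x : ℝ) ^ (((f i).natDegree : ℝ) / U)⌉₊,
              p.Prime → ¬ ((p : ℤ) ∣ (f i).eval (n : ℤ)))).filter (fun n : ℕ =>
            ∀ i, Odd (ArithmeticFunction.cardFactors (((f i).eval (n : ℤ)).toNat)))).card : ℕ) : ℝ) -
          ((((Finset.Icc 1 x).filter (fun n : ℕ => ∀ i, 0 < (f i).eval (n : ℤ) ∧
            ∀ p ∈ Finset.range ⌈(x : ℝ) ^ (((f i).natDegree : ℝ) / U)⌉₊,
              p.Prime → ¬ ((p : ℤ) ∣ (f i).eval (n : ℤ)))).card : ℕ) : ℝ)| ≤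
        δ * ((((Finset.Icc 1 x).filter (fun n : ℕ => ∀ i, 0 < (f i).eval (n : ℤ) ∧
            ∀ p ∈ Finset.range ⌈(x : ℝ) ^ (((f i).natDegree : ℝ) / U)⌉₊,
              p.Prime → ¬ ((p : ℤ) ∣ (f i).eval (n : ℤ)))).card : ℕ) : ℝ) := by
  intro k f hf δ hδ
  have hδ' : (0 : ℝ) < δ / 2 ^ k := by positivity
  -- per-subset bound at tolerance δ/2^k (vacuous for `S = ∅`)
  have key : ∀ S : Finset (Fin k), ∃ U₀ : ℝ, ∀ U : ℝ, U₀ ≤ U → ∀ᶠ x : ℕ in Filter.atTop,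
      S.Nonempty →
        |∑ n ∈ (Finset.Icc 1 x).filter (fun n : ℕ => ∀ i, 0 < (f i).eval (n : ℤ) ∧
            ∀ p ∈ Finset.range ⌈(x : ℝ) ^ (((f i).natDegree : ℝ) / U)⌉₊,
              p.Prime → ¬ ((p : ℤ) ∣ (f i).eval (n : ℤ))),
            ∏ i ∈ S, (-1 : ℝ) ^ ArithmeticFunction.cardFactors (((f i).eval (n : ℤ)).toNat)| ≤
          δ / 2 ^ k * ((((Finset.Icc 1 x).filter (fun n : ℕ => ∀ i, 0 < (f i).eval (n : ℤ) ∧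
            ∀ p ∈ Finset.range ⌈(x : ℝ) ^ (((f i).natDegree : ℝ) / U)⌉₊,
              p.Prime → ¬ ((p : ℤ) ∣ (f i).eval (n : ℤ)))).card : ℕ) : ℝ) := by
    intro S
    by_cases hS0 : S = ∅
    · subst hS0
      exact ⟨0, fun U _ => Filter.Eventually.of_forall fun x h => absurd h Finset.not_nonempty_empty⟩
    by_cases hS2 : 2 ≤ S.card
    · obtain ⟨U₀, hU₀⟩ := h₃ k f hf S hS2 (δ / 2 ^ k) hδ'
      exact ⟨U₀, fun U hU => (hU₀ U hU).mono fun x hx _ => hx⟩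
    · have hS1 : S.card = 1 := by
        have := Finset.card_pos.2 (Finset.nonempty_iff_ne_empty.2 hS0)
        omega
      obtain ⟨i, rfl⟩ := Finset.card_eq_one.1 hS1
      by_cases hd : (f i).natDegree = 1
      · obtain ⟨U₀, hU₀⟩ := h₁ k f hf i hd (δ / 2 ^ k) hδ'
        refine ⟨U₀, fun U hU => (hU₀ U hU).mono fun x hx _ => ?_⟩
        simpa only [Finset.prod_singleton] using hx
      · have hd2 : 2 ≤ (f i).natDegree := by
          have := hf.natDegree_pos i
          omega
        obtain ⟨U₀, hU₀⟩ := h₂ k f hf i hd2 (δ / 2 ^ k) hδ'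
        refine ⟨U₀, fun U hU => (hU₀ U hU).mono fun x hx _ => ?_⟩
        simpa only [Finset.prod_singleton] using hx
  choose U₀ hU₀ using key
  refine ⟨Finset.univ.sup' Finset.univ_nonempty U₀, fun U hU => ?_⟩
  have hUS : ∀ S : Finset (Fin k), U₀ S ≤ U := fun S =>
    (Finset.le_sup' U₀ (Finset.mem_univ S)).trans hU
  have hev := Filter.eventually_all.2 fun S : Finset (Fin k) => hU₀ S U (hUS S)
  filter_upwards [hev] with x hx
  -- abbreviate the rough set and the sign
  set R : Finset ℕ := (Finset.Icc 1 x).filter (fun n : ℕ => ∀ i, 0 < (f i).eval (n : ℤ) ∧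
      ∀ p ∈ Finset.range ⌈(x : ℝ) ^ (((f i).natDegree : ℝ) / U)⌉₊,
        p.Prime → ¬ ((p : ℤ) ∣ (f i).eval (n : ℤ))) with hR
  -- Walsh
  have hW := walsh_allOdd R (fun (i : Fin k) (n : ℕ) => ArithmeticFunction.cardFactors (((f i).eval (n : ℤ)).toNat))
  simp only [Fintype.card_fin] at hW
  rw [hW, ← Finset.add_sum_erase _ _ (Finset.mem_univ (∅ : Finset (Fin k)))]
  simp only [Finset.card_empty, pow_zero, Finset.prod_empty, Finset.sum_const, nsmul_eq_mul, mul_one,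
    one_mul, add_sub_cancel_left]
  -- triangle inequality over the non-empty subsets
  have hcardR : (0 : ℝ) ≤ (R.card : ℝ) := Nat.cast_nonneg _
  calc |∑ S ∈ (Finset.univ : Finset (Finset (Fin k))).erase ∅,
          (-1 : ℝ) ^ S.card * ∑ n ∈ R, ∏ i ∈ S, (-1 : ℝ) ^ ArithmeticFunction.cardFactors (((f i).eval (n : ℤ)).toNat)|
      ≤ ∑ S ∈ (Finset.univ : Finset (Finset (Fin k))).erase ∅,
          |(-1 : ℝ) ^ S.card * ∑ n ∈ R, ∏ i ∈ S, (-1 : ℝ) ^ ArithmeticFunction.cardFactors (((f i).eval (n : ℤ)).toNat)| :=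
        Finset.abs_sum_le_sum_abs _ _
    _ ≤ ∑ S ∈ (Finset.univ : Finset (Finset (Fin k))).erase ∅, δ / 2 ^ k * (R.card : ℝ) := by
        refine Finset.sum_le_sum fun S hS => ?_
        have hSne : S.Nonempty := Finset.nonempty_iff_ne_empty.2 (Finset.ne_of_mem_erase hS)
        rw [abs_mul, abs_pow, abs_neg, abs_one, one_pow, one_mul]
        exact hx S hSne
    _ ≤ ∑ S ∈ (Finset.univ : Finset (Finset (Fin k))), δ / 2 ^ k * (R.card : ℝ) :=
        Finset.sum_le_sum_of_subset_of_nonneg (Finset.erase_subset _ _) fun _ _ _ => by positivity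
    _ = δ * (R.card : ℝ) := by
        rw [Finset.sum_const, Finset.card_univ, Fintype.card_finset, Fintype.card_fin, nsmul_eq_mul]
        push_cast
        field_simp

/-- **§D6 glue (PROVED): the route-level split is ready.**  The two atoms imply the crux BY NAME, using
the LANDED linear-member theorem `Birth.stub_linearMemberSign` (p149574). If a tenure planner wants the
atoms as items: `route edit --split RoughParityBalance --into [NonlinearMemberSign, JointSignIndependence]`
with this theorem (landed under `Theorems/`) as `--glue-by`. [folklore assembly] -/
theorem RoughParityBalance_of_subs : NonlinearMemberSign → JointSignIndependence → RoughParityBalance :=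
  fun h₂ h₃ => roughParityBalance_of_parts Birth.stub_linearMemberSign h₂ h₃

/-! ## §D3  The seam of the medium/large parity-mixing split (finite-set algebra) -/

/-- For `±1`-valued `b`: `Σ_R a·b = Σ_{R, b = 1} a − Σ_{R, b = −1} a`. [folklore] -/
theorem sum_mul_sign_eq_sub {α : Type*} (R : Finset α) (a b : α → ℝ)
    (hb : ∀ n ∈ R, b n = 1 ∨ b n = -1) :
    ∑ n ∈ R, a n * b n = ∑ n ∈ R.filter (fun n => b n = 1), a n - ∑ n ∈ R.filter (fun n => b n = -1), a n := by
  classical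
  have hsplit := (Finset.sum_filter_add_sum_filter_not R (fun n => b n = 1) (fun n => a n * b n)).symm
  rw [hsplit]
  have h1 : ∑ n ∈ R.filter (fun n => b n = 1), a n * b n = ∑ n ∈ R.filter (fun n => b n = 1), a n :=
    Finset.sum_congr rfl fun n hn => by rw [(Finset.mem_filter.mp hn).2, mul_one]
  have hneg : R.filter (fun n => ¬ b n = 1) = R.filter (fun n => b n = -1) := by
    refine Finset.filter_congr fun n hn => ?_
    rcases hb n hn with h | h
    · simp only [h, not_true_eq_false, false_iff]; norm_num
    · constructor
      · intro _; exact h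
      · intro _; rw [h]; norm_num
  have h2 : ∑ n ∈ R.filter (fun n => ¬ b n = 1), a n * b n = -∑ n ∈ R.filter (fun n => b n = -1), a n := by
    rw [hneg, ← Finset.sum_neg_distrib]
    exact Finset.sum_congr rfl fun n hn => by rw [(Finset.mem_filter.mp hn).2]; ring
  rw [h1, h2]; ring

/-- Conversely `2·Σ_{R, b = 1} a = Σ_R a + Σ_R a·b`: once `Σ_R a` is small, "`a` balanced on the class
`b = 1`" is EQUIVALENT to "`Σ a·b` small" — the conditional piece of the D3 split restates the product
statement (costume certificate). [folklore] -/
theorem two_mul_sum_filter_eq {α : Type*} (R : Finset α) (a b : α → ℝ)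
    (hb : ∀ n ∈ R, b n = 1 ∨ b n = -1) :
    2 * ∑ n ∈ R.filter (fun n => b n = 1), a n = ∑ n ∈ R, a n + ∑ n ∈ R, a n * b n := by
  classical
  rw [sum_mul_sign_eq_sub R a b hb]
  have hsplit := (Finset.sum_filter_add_sum_filter_not R (fun n => b n = 1) a)
  have hneg : R.filter (fun n => ¬ b n = 1) = R.filter (fun n => b n = -1) := by
    refine Finset.filter_congr fun n hn => ?_
    rcases hb n hn with h | h
    · simp only [h, not_true_eq_false, false_iff]; norm_num
    · constructor
      · intro _; exact h
      · intro _; rw [h]; norm_num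
  rw [hneg] at hsplit
  linarith

/-! ## §T6  Two out of three, per system (LANDED): `BH_f ∧ A_f ⟹ P_f` -/

/-- The transfer "solve the sibling where Bateman–Horn is known" is exactly this landed theorem; it gives
the crux for a system `f` only where `BatemanHornAsymptotic f` AND the share statement are theorems —
today: `k = 1`, `f` linear (Dirichlet + Alladi in progressions), where the crux is already a theorem. -/
example {k : ℕ} {f : Fin k → Polynomial ℤ} (hf : IsBatemanHornSystem f) (hBH : BatemanHornAsymptotic f) :=
  Summit.Parity.BatemanHorn.Cruxes.OddSectorShareNonlinear.Birth.Exactness.balance_of_asymptotic_of_share hf hBH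

end Summit.Parity.BatemanHorn.Cruxes.RoughParityBalance.StrategistS1
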